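import Literature.IUT.HodgeArakelov.GaloisPairRigidityGenuine
import Literature.IUT.HodgeTheaters.GlobalFrobenioidsCyclotomeRigidityZHat
import Literature.AnabelianGeometry.AbsoluteAnabelian.AbsTopIII.EquivariantUnitExponents
import Literature.AnabelianGeometry.AbsoluteAnabelian.MLFGaloisUnitsFunctors
import HarnessLib

/-!
# [IUTchII] Rmk 1.11.1 (i) (b) / Ex 1.8 (iv): the natural `Ẑ^×`-action on `O^×(G) = 𝒪_k̄^×` at the genuine producers
# — THE `Ẑ^×`-powers `x ↦ x^u` as a HOMOMORPHISM `Ẑ^× → Aut(𝒪_k̄^×)` (def-bearing; MERGE-MAP B9, units side)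

S. Mochizuki, *Inter-universal Teichmüller theory II*, §1, kurims manuscript (Dec. 2020): Remark 1.11.1 (i) (b) p. 50
«the group of automorphisms of the MLF-Galois TM-pair `G ↷ O^×(G)` maps surjectively … onto `Aut(G)`, with kernel given
by the [`G`-linear] automorphisms of the underlying ind-topological module of `O^×(G)` determined by the natural action
of `Ẑ^×` [cf. [AbsTopIII], Proposition 3.3, (ii)]»; Example 1.8 (iii)/(iv) pp. 37–39 («we may think of `Γ ⊆ Ẑ^×` as
acting on the output data of the algorithms (∗×) via the natural action of `Ẑ^×`») [claim: Mochizuki2012, status: disputed]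
(IUTchII §1 Rmk 1.11.1 (i), kurims p.50); S. Mochizuki, *Topics in absolute anabelian geometry III*, Prop. 3.3 (ii)
p. 74 [MochizukiAbsTopIII2015]. abc-iut cell, layer L6, seat abc-iut-w6-d010, row «RMK1111B-GENUINE» (FACT-LIST F-0418
`Rmk1111_b` residual, as isolated by abc-iut-w6-d016: «kernel clauses at a genuine `Ẑ^×`-exponentiation on `O^×`»).

abc-iut-L6-t1's named fact `Rmk1111_b A zhatPow` (`GaloisPairRigidity.lean`) takes the `Ẑ^×`-action `zhatPow` on the
units `O^×(G)` as an interface PARAMETER («profinite exponentiation on `O^×` is not in the tree»). For the GENUINE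
producers (`O^⊳(G) = 𝒪_k̄^⊳`, abc-iut-L6-t13 / abc-iut-L6-d2) this file CONSTRUCTS it — exactly [AbsTopIII] Prop. 3.3
(ii)'s description: the elements of `Ẑ^× = Aut(Ẑ)` (the tree's `ZHatUnits`) are compatible unit exponent systems
(`Genuine.levelExp u n = χ_n(u)`, `ZHatLevel.levelChar`), and for such a system abc-iut-L6-d1's
`MLFClosure.exists_equivariant_unitMulEquiv_of_compatible` / `equivariant_unitMulEquiv_eq_of_rootsOfUnity`
(`AbsTopIII/EquivariantUnitExponents.lean`) give THE UNIQUE `Gal(k̄/k)`-equivariant automorphism `x ↦ x^u` of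
`𝒪_k̄^× = unitSubmonoid k k̄` acting as `ζ ↦ ζ^{χ_m(u)}` on `μ_m`:

* `Genuine.zhatUnitAut C u` (= `x ↦ x^u`), `zhatUnitAut_equivariant`, `coe_zhatUnitAut_of_pow_eq_one`,
  `zhatUnitAut_unique`, and the HOMOMORPHISM `Genuine.zhatPowUnits C : Ẑ^× →* Aut(𝒪_k̄^×)` (laws by uniqueness);
* `Genuine.zhatPowOunits C : Ẑ^× →* Aut((𝒪_k̄^⊳)ˣ)` — the same transported to the units `O^×(G) = (O^⊳(G))ˣ` of the
  genuine producers along abc-iut-L4-t2's `ModelMLFGaloisData.unitsEquivUnitSubmonoid`, with `coe_zhatPowOunits`,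
  `coe_zhatPowOunits_of_pow_eq_one` and the `G`-LINEARITY `zhatPowOunits_actOunits` (third clause of `Rmk1111_b` at
  the genuine producers).
The proof-only sequel `GaloisPairRigidityRmk1111bGenuine.lean` proves the converse (every `G`-linear automorphism of
`O^×(G)` IS `zhatPowOunits u`) and `Rmk1111_b (genuineOfModel …) (fun _ => zhatPowOunits C)`.

HONEST FRAMING: classical constructions ([AbsTopIII] + Kummer theory of MLFs, all inputs PROVED in the tree); record-only
vocabulary under a disputed claim key as far as [IUTchII]'s words go; nothing here bears on [IUTchIII] Cor. 3.12.
-/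

noncomputable section

namespace Literature.IUT.HodgeArakelov

open CategoryTheory
open Literature.AnabelianGeometry.AbsoluteAnabelian

namespace AbsTopMonoids

namespace Genuine

/-! ## `Ẑ^×` as compatible unit exponent systems -/

/-- The exponent system of `u ∈ Ẑ^× = Aut(Ẑ)`: `levelExp u n := χ_n(u) ∈ {0, …, n−1}` for `n ≥ 1` (the level-`n`
cyclotomic character `ZHatLevel.levelChar`; value `1` at the unused index `n = 0`).
[cite: MochizukiAbsTopIII2015, Proposition 3.3 (ii) p.74] -/
def levelExp (u : ZHatUnits) (n : ℕ) : ℕ :=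
  if h : 0 < n then (Literature.AnabelianGeometry.EtaleTheta.ZHatLevel.levelChar ⟨n, h⟩ u).val else 1

/-- `levelExp u n = χ_n(u)` for `n ≥ 1`. [cite: MochizukiAbsTopIII2015, Proposition 3.3 (ii) p.74] -/
theorem levelExp_of_pos (u : ZHatUnits) {n : ℕ} (hn : 0 < n) :
    levelExp u n = (Literature.AnabelianGeometry.EtaleTheta.ZHatLevel.levelChar ⟨n, hn⟩ u).val :=
  dif_pos hn

/-- The exponent system of `u` is COMPATIBLE: `χ_n(u) ≡ χ_m(u) (mod m)` for `m ∣ n` (abc-iut L5's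
`CyclotomeRigidity.levelChar_val_modEq`). [cite: MochizukiAbsTopIII2015, Proposition 3.3 (ii) p.74] -/
theorem levelExp_modEq (u : ZHatUnits) (m n : ℕ) (hm : 0 < m) (hn : 0 < n) (hmn : m ∣ n) :
    levelExp u n ≡ levelExp u m [MOD m] := by
  rw [levelExp_of_pos u hn, levelExp_of_pos u hm]
  exact Literature.IUT.HodgeTheaters.CyclotomeRigidity.levelChar_val_modEq u m n hm hn hmn

/-- The exponent system of `u` is a UNIT system: `χ_n(u)` is prime to `n`
(`CyclotomeRigidity.levelChar_val_coprime`). [cite: MochizukiAbsTopIII2015, Proposition 3.3 (ii) p.74] -/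
theorem levelExp_coprime (u : ZHatUnits) (n : ℕ) (hn : 0 < n) : (levelExp u n).Coprime n := by
  rw [levelExp_of_pos u hn]
  exact Literature.IUT.HodgeTheaters.CyclotomeRigidity.levelChar_val_coprime u ⟨n, hn⟩

/-- `χ_m(1) = 1 % m`. [cite: MochizukiAbsTopIII2015, Proposition 3.3 (ii) p.74] -/
theorem levelExp_one {m : ℕ} (hm : 0 < m) : levelExp 1 m = 1 % m := by
  rw [levelExp_of_pos 1 hm, map_one, ZMod.val_one_eq_one_mod]
  rfl

/-- `χ_m(u v) = (χ_m(u) χ_m(v)) % m`. [cite: MochizukiAbsTopIII2015, Proposition 3.3 (ii) p.74] -/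
theorem levelExp_mul (u v : ZHatUnits) {m : ℕ} (hm : 0 < m) :
    levelExp (u * v) m = (levelExp u m * levelExp v m) % m := by
  rw [levelExp_of_pos _ hm, levelExp_of_pos _ hm, levelExp_of_pos _ hm, map_mul, ZMod.val_mul]
  rfl

variable (C : MLFClosure.{0})

/-- `Gal(k̄/k)`-EQUIVARIANCE of a multiplicative automorphism of `𝒪_k̄^× = unitSubmonoid k k̄`, in abc-iut-L6-d1's
element form («`(y : k̄) = σ x ⟹ (β y : k̄) = σ (β x)`»). [cite: MochizukiAbsTopIII2015, Proposition 3.3 (ii) p.74] -/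
def UnitsGalEquivariant (β : unitSubmonoid C.k C.K ≃* unitSubmonoid C.k C.K) : Prop :=
  ∀ (σ : C.K ≃ₐ[C.k] C.K) (x y : unitSubmonoid C.k C.K), (y : C.K) = σ x →
    ((β y : unitSubmonoid C.k C.K) : C.K) = σ ((β x : unitSubmonoid C.k C.K) : C.K)

/-- The identity is equivariant. [cite: MochizukiAbsTopIII2015, Proposition 3.3 (ii) p.74] -/
theorem unitsGalEquivariant_refl : UnitsGalEquivariant C (MulEquiv.refl _) := fun _ _ _ h => h

/-- Equivariant automorphisms compose (product in `MulAut`: `(β₁ β₂) x = β₁ (β₂ x)`).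
[cite: MochizukiAbsTopIII2015, Proposition 3.3 (ii) p.74] -/
theorem unitsGalEquivariant_mul {β₁ β₂ : unitSubmonoid C.k C.K ≃* unitSubmonoid C.k C.K}
    (h₁ : UnitsGalEquivariant C β₁) (h₂ : UnitsGalEquivariant C β₂) : UnitsGalEquivariant C (β₁ * β₂) :=
  fun σ x y h => h₁ σ (β₂ x) (β₂ y) (h₂ σ x y h)

/-! ## THE `Ẑ^×`-power automorphisms of `𝒪_k̄^×` -/

/-- **`x ↦ x^u` on `𝒪_k̄^×`** for `u ∈ Ẑ^×`: THE `Gal(k̄/k)`-equivariant multiplicative automorphism of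
`𝒪_k̄^× = unitSubmonoid k k̄` acting on the `m`-th roots of unity by `ζ ↦ ζ^{χ_m(u)}` (existence: abc-iut-L6-d1's
`MLFClosure.exists_equivariant_unitMulEquiv_of_compatible` at the exponent system `levelExp u`; uniqueness:
`zhatUnitAut_unique`). [cite: MochizukiAbsTopIII2015, Proposition 3.3 (ii) p.74] -/
def zhatUnitAut (u : ZHatUnits) : unitSubmonoid C.k C.K ≃* unitSubmonoid C.k C.K :=
  (C.exists_equivariant_unitMulEquiv_of_compatible (levelExp u)
    (fun m n hm hn hmn => levelExp_modEq u m n hm hn hmn) (fun n hn => levelExp_coprime u n hn)).choose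

/-- `x ↦ x^u` is `Gal(k̄/k)`-equivariant. [cite: MochizukiAbsTopIII2015, Proposition 3.3 (ii) p.74] -/
theorem zhatUnitAut_equivariant (u : ZHatUnits) : UnitsGalEquivariant C (zhatUnitAut C u) :=
  (C.exists_equivariant_unitMulEquiv_of_compatible (levelExp u)
    (fun m n hm hn hmn => levelExp_modEq u m n hm hn hmn) (fun n hn => levelExp_coprime u n hn)).choose_spec.1

/-- `x ↦ x^u` acts on an `m`-th root of unity `ζ ∈ 𝒪_k̄^×` by `ζ ↦ ζ^{χ_m(u)}`.
[cite: MochizukiAbsTopIII2015, Proposition 3.3 (ii) p.74] -/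
theorem coe_zhatUnitAut_of_pow_eq_one (u : ZHatUnits) (x : unitSubmonoid C.k C.K) (m : ℕ) (hm : 0 < m)
    (hx : (x : C.K) ^ m = 1) :
    ((zhatUnitAut C u x : unitSubmonoid C.k C.K) : C.K) = (x : C.K) ^ levelExp u m :=
  (C.exists_equivariant_unitMulEquiv_of_compatible (levelExp u)
    (fun m n hm hn hmn => levelExp_modEq u m n hm hn hmn) (fun n hn => levelExp_coprime u n hn)).choose_spec.2.1
    x m hm hx

/-- **Uniqueness** ([AbsTopIII] Prop. 3.3 (ii), abc-iut-L6-d1's rigidity `equivariant_unitMulEquiv_eq_of_rootsOfUnity`):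
a `Gal(k̄/k)`-equivariant automorphism of `𝒪_k̄^×` acting on roots of unity by `ζ ↦ ζ^{χ_m(u)}` IS `x ↦ x^u`.
[cite: MochizukiAbsTopIII2015, Proposition 3.3 (ii) p.74] -/
theorem zhatUnitAut_unique (u : ZHatUnits) (β : unitSubmonoid C.k C.K ≃* unitSubmonoid C.k C.K)
    (hβ : UnitsGalEquivariant C β)
    (hμ : ∀ (x : unitSubmonoid C.k C.K) (m : ℕ), 0 < m → (x : C.K) ^ m = 1 →
      ((β x : unitSubmonoid C.k C.K) : C.K) = (x : C.K) ^ levelExp u m) :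
    β = zhatUnitAut C u :=
  C.equivariant_unitMulEquiv_eq_of_rootsOfUnity β (zhatUnitAut C u) hβ (zhatUnitAut_equivariant C u)
    fun x m hm hx => Subtype.ext ((hμ x m hm hx).trans (coe_zhatUnitAut_of_pow_eq_one C u x m hm hx).symm)

/-- `x ↦ x^1` is the identity. [cite: MochizukiAbsTopIII2015, Proposition 3.3 (ii) p.74] -/
theorem zhatUnitAut_one : zhatUnitAut C 1 = 1 :=
  (zhatUnitAut_unique C 1 1 (unitsGalEquivariant_refl C) fun x m hm hx => by
    rw [levelExp_one hm, ← pow_eq_pow_mod 1 hx, pow_one]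
    rfl).symm

/-- `x ↦ x^{uv}` is `x ↦ (x^v)^u`. [cite: MochizukiAbsTopIII2015, Proposition 3.3 (ii) p.74] -/
theorem zhatUnitAut_mul (u v : ZHatUnits) : zhatUnitAut C (u * v) = zhatUnitAut C u * zhatUnitAut C v := by
  refine (zhatUnitAut_unique C (u * v) _
    (unitsGalEquivariant_mul C (zhatUnitAut_equivariant C u) (zhatUnitAut_equivariant C v)) fun x m hm hx => ?_).symm
  have hv := coe_zhatUnitAut_of_pow_eq_one C v x m hm hx
  have hvm : ((zhatUnitAut C v x : unitSubmonoid C.k C.K) : C.K) ^ m = 1 := by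
    rw [hv, ← pow_mul, mul_comm, pow_mul, hx, one_pow]
  have hu := coe_zhatUnitAut_of_pow_eq_one C u (zhatUnitAut C v x) m hm hvm
  rw [MulAut.mul_apply, hu, hv, ← pow_mul, levelExp_mul u v hm, ← pow_eq_pow_mod _ hx, mul_comm]

/-- **The natural `Ẑ^×`-action on `𝒪_k̄^×`** ([AbsTopIII] Prop. 3.3 (ii); [IUTchII] Rmk 1.11.1 (i) (b) «the natural action
of `Ẑ^×`»): `u ↦ (x ↦ x^u)`, a HOMOMORPHISM `Ẑ^× → Aut(𝒪_k̄^×)`. [claim: Mochizuki2012, status: disputed]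
(IUTchII §1 Rmk 1.11.1 (i), kurims p.50) -/
def zhatPowUnits : ZHatUnits →* MulAut (unitSubmonoid C.k C.K) where
  toFun := zhatUnitAut C
  map_one' := zhatUnitAut_one C
  map_mul' := zhatUnitAut_mul C

/-- `zhatPowUnits C u = (x ↦ x^u)`. [cite: MochizukiAbsTopIII2015, Proposition 3.3 (ii) p.74] -/
@[simp] theorem zhatPowUnits_apply (u : ZHatUnits) : zhatPowUnits C u = zhatUnitAut C u := rfl

/-! ## Transport to the units `O^×(G) = (𝒪_k̄^⊳)ˣ` of the genuine producers -/

/-- **The natural `Ẑ^×`-action on `O^×(G) = (O^⊳(G))ˣ = (𝒪_k̄^⊳)ˣ`** of the genuine producers: `zhatPowUnits`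
transported along abc-iut-L4-t2's `(𝒪_k̄^⊳)ˣ ≅ 𝒪_k̄^×` (`ModelMLFGaloisData.unitsEquivUnitSubmonoid`). This is the
`zhatPow` datum of abc-iut-L6-t1's `Rmk1111_b` for `A = genuineOfModel … / genuineOfModelIsm …` (constant in `G`).
[claim: Mochizuki2012, status: disputed] (IUTchII §1 Rmk 1.11.1 (i), kurims p.50) -/
def zhatPowOunits : ZHatUnits →* MulAut (nonzeroIntegers C.k C.K)ˣ where
  toFun u := ((ModelMLFGaloisData.unitsEquivUnitSubmonoid C).trans (zhatUnitAut C u)).trans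
    (ModelMLFGaloisData.unitsEquivUnitSubmonoid C).symm
  map_one' := by
    ext x
    rw [zhatUnitAut_one]
    simp
  map_mul' u v := by
    ext x
    rw [zhatUnitAut_mul]
    simp

/-- Underlying elements of `k̄`: `zhatPowOunits` IS `x ↦ x^u` read through `(𝒪_k̄^⊳)ˣ ≅ 𝒪_k̄^×`.
[cite: MochizukiAbsTopIII2015, Proposition 3.3 (ii) p.74] -/
theorem coe_zhatPowOunits (u : ZHatUnits) (x : (nonzeroIntegers C.k C.K)ˣ) :
    (((zhatPowOunits C u x : (nonzeroIntegers C.k C.K)ˣ) : nonzeroIntegers C.k C.K) : C.K) =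
      ((zhatUnitAut C u (ModelMLFGaloisData.unitsEquivUnitSubmonoid C x) : unitSubmonoid C.k C.K) : C.K) := by
  change ((((ModelMLFGaloisData.unitsEquivUnitSubmonoid C).symm
      (zhatUnitAut C u (ModelMLFGaloisData.unitsEquivUnitSubmonoid C x)) : (nonzeroIntegers C.k C.K)ˣ) :
        nonzeroIntegers C.k C.K) : C.K) = _
  rw [← ModelMLFGaloisData.coe_unitsEquivUnitSubmonoid C, MulEquiv.apply_symm_apply]

/-- `zhatPowOunits C u` acts on an `m`-th root of unity `ζ ∈ (𝒪_k̄^⊳)ˣ` by `ζ ↦ ζ^{χ_m(u)}`.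
[cite: MochizukiAbsTopIII2015, Proposition 3.3 (ii) p.74] -/
theorem coe_zhatPowOunits_of_pow_eq_one (u : ZHatUnits) (x : (nonzeroIntegers C.k C.K)ˣ) (m : ℕ) (hm : 0 < m)
    (hx : ((x : nonzeroIntegers C.k C.K) : C.K) ^ m = 1) :
    (((zhatPowOunits C u x : (nonzeroIntegers C.k C.K)ˣ) : nonzeroIntegers C.k C.K) : C.K) =
      ((x : nonzeroIntegers C.k C.K) : C.K) ^ levelExp u m := by
  rw [coe_zhatPowOunits, coe_zhatUnitAut_of_pow_eq_one C u _ m hm] <;>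
    simp [ModelMLFGaloisData.coe_unitsEquivUnitSubmonoid, hx]

/-- `zhatPowOunits C u` commutes with every field automorphism of `k̄/k` acting on `(𝒪_k̄^⊳)ˣ` (equivariance read
on underlying elements). [cite: MochizukiAbsTopIII2015, Proposition 3.3 (ii) p.74] -/
theorem coe_zhatPowOunits_of_coe_eq (u : ZHatUnits) (σ : C.K ≃ₐ[C.k] C.K) (x y : (nonzeroIntegers C.k C.K)ˣ)
    (h : ((y : nonzeroIntegers C.k C.K) : C.K) = σ ((x : nonzeroIntegers C.k C.K) : C.K)) :
    (((zhatPowOunits C u y : (nonzeroIntegers C.k C.K)ˣ) : nonzeroIntegers C.k C.K) : C.K) =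
      σ (((zhatPowOunits C u x : (nonzeroIntegers C.k C.K)ˣ) : nonzeroIntegers C.k C.K) : C.K) := by
  rw [coe_zhatPowOunits, coe_zhatPowOunits]
  exact zhatUnitAut_equivariant C u σ _ _ (by simpa [ModelMLFGaloisData.coe_unitsEquivUnitSubmonoid] using h)

variable (S : ThetaSetting.{0}) (ε : S.Gk ≃ₜ* (ModelMLFGaloisData.galois C.k C.K).tmPair.Pi)
  (hΔ : ∀ f : S.PiX ≃ₜ* S.PiX, S.DeltaX.map f.toMulEquiv.toMonoidHom = S.DeltaX)
  (hq : Nonempty (TopGroup.quot S.PiX S.DeltaX ≃ₜ* S.Gk))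

/-- **`G`-LINEARITY at the genuine producer** (third clause of `Rmk1111_b`: «every `(1, x ↦ x^u)` is a pair», i.e. the
`Ẑ^×`-action is `G`-linear): `zhatPowOunits C u` commutes with the action `actOunits G g` of every `g ∈ G` — which is
the Galois action of `theta g` (`genuineOfModel_actOtri_apply`). [claim: Mochizuki2012, status: disputed]
(IUTchII §1 Rmk 1.11.1 (i), kurims p.50) -/
theorem zhatPowOunits_actOunits (G : IsoClass S.Gk) (u : ZHatUnits) (g : G.G)
    (x : (genuineOfModel S C ε hΔ hq).Ounits G) :
    zhatPowOunits C u ((genuineOfModel S C ε hΔ hq).actOunits G g x) =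
      (genuineOfModel S C ε hΔ hq).actOunits G g (zhatPowOunits C u x) := by
  apply Units.ext
  apply Subtype.ext
  exact coe_zhatPowOunits_of_coe_eq C u (theta C ε G g) x _ rfl

/-- The pair `(1, x ↦ x^u)` IS an automorphism of `G ↷ O^×(G)` over `1 ∈ Aut(G)` at the genuine producer (the
membership form used by `Rmk1111_b` / `PairAut`). [claim: Mochizuki2012, status: disputed] (IUTchII §1 Rmk 1.11.1 (i), kurims p.50) -/
theorem one_zhatPowOunits_mem_pairAut (G : IsoClass S.Gk) (u : ZHatUnits) :
    ((1 : Aut G), zhatPowOunits C u) ∈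
      PairAut G ((genuineOfModel S C ε hΔ hq).Ounits G) ((genuineOfModel S C ε hΔ hq).actOunits G) :=
  fun g x => zhatPowOunits_actOunits C S ε hΔ hq G u g x

end Genuine

end AbsTopMonoids

end Literature.IUT.HodgeArakelov

end
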